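import Summits.ABC.IUTFork.Joshi.ArithTeichmullerAction
import HarnessLib

/-!
# Joshi, *Arithmetic Teichmüller spaces I* (v4) — the functors to ANALYTIC SPACES (Thm 5.25.1 (4)) and Thm 3.16.1
# («the absolute Grothendieck conjecture is false for Berkovich spaces») over an abstract analytic-space signature

Record file of the abc-iut cell, branch E (seat abc-iut-E-t1, [J-I] carrier owner; closes the last sub-row of this seat's core in
plan/E/JOSHI-DAG: Thm 5.25.1 (4) / old (th:main4.5) (3) «functors to analytic spaces», and gives Thm 3.16.1 a typed home — only its
USE `ATSObj.not_isIso_of_not_topIso` existed, p428170). TAKES NO SIDE on [IUTchIII] Cor. 3.12 or on any author; typed ≠ proved ≠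
endorsed. Source: K. Joshi, arXiv 2106.11452 **v4** (render `HOME/plan/repair/lit/renders/Joshi-ATS1-2106.11452v4-…`): **Thm 5.25.1
(4)** p.36 l.35 (header) + p.37 l.19–31 «There are functors to analytic spaces (see Proposition 4.1.10) `(Y/E′, (E′ ↪ K, K♭ ≃ F), ∗_K) ↦ Y^an_{E′}`,
`… ↦ Y^an_K`, `… ↦ (Y^an_K → Y^an_{E′})`»; **Thm 3.16.1** p.15 l.29–44 «Let X/E be a geometrically connected, smooth projective
variety. Let K₁, K₂ be two untilts of ℂ♭_p which contain E. Suppose that K₁, K₂ are not topologically isomorphic. Then (1) one has an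
isomorphism of topological groups Π^temp_{X/K₁} ≃ Π^temp_{X/K₂}, (2) but the analytic spaces X^an/K₁ and X^an/K₂ are not isomorphic as
analytic spaces over ℚ_p (in the sense of §3.13). (3) In particular the Absolute Grothendieck Conjecture fails in the category of
Berkovich spaces over perfectoid fields of characteristic zero» (2021 render: §3 Thm (thm:main2), chunk p0011).
[claim: Joshi2021ATS1, status: disputed]

INTERFACE BOUNDARY. Berkovich analytic spaces, analytification and «isomorphism of analytic spaces over ℚ_p» (§3.13: bounded
isomorphism of Banach rings over ℚ_p) are NOT in Mathlib or the tree. They enter as the SIGNATURE `AnalyticSpaces p` below (a type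
of analytic spaces over ℚ_p, their ℚ_p-isomorphism relation, and the two analytification functions `Y ↦ Y^an_{E′}`,
`(Y, E′ ↪ K) ↦ Y^an_K`) — pure data, nothing asserted; E-t10's per-curve `ATS1.BerkovichDatum` (base points) is the
companion signature on the base-point side. Over it: the two functors ON OBJECTS of `𝔍(X,E)` (`ATSObj.anBase`, `ATSObj.anOver`) and
Thm 3.16.1 (2) as the claim-Prop `Thm3161` (never asserted); the group-theoretic clause (1) is the tree's reading that the geometric
subgroup is independent of `K` (`ATSObj.geomSubgroup`, p428170), recorded as `thm3161_clause1`.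
-/

noncomputable section

namespace Summit.ABC.IUTFork.Joshi

open Literature.AnabelianGeometry.SemiGraphs (TemperedCurve)

universe u

variable (p : ℕ) [Fact p.Prime]

/-- SIGNATURE for the Berkovich side of ATS I ([J-I] v4 §3.13 p.13 l.10–32: «an analytic space over E is a K-analytic space for some valued
field K ⊇ E … one can consider the notion of (iso)morphisms X^an_{K₁} ≃ X^an_{K₂} of analytic spaces over E … over ℚ_p … the p-adic
analytic analog of the notion of isomorphisms of schemes over ℤ»): a type of analytic spaces over `ℚ_p`, the relation «isomorphic
as analytic spaces over `ℚ_p`», and the analytifications `Y ↦ Y^an_{E′}` of a curve and `(Y, E′ ↪ K) ↦ Y^an_K = (Y ×_{E′} K)^an` of its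
base change to an untilt. Pure data; nothing about Berkovich spaces is built in. [claim: Joshi2021ATS1, status: disputed] -/
structure AnalyticSpaces : Type (u + 1) where
  /-- analytic spaces over `ℚ_p` -/
  An : Type u
  /-- «isomorphic as analytic spaces over `ℚ_p`» (§3.13) -/
  IsoQp : An → An → Prop
  /-- it is an equivalence relation -/
  isoQp_equiv : Equivalence IsoQp
  /-- `Y ↦ Y^an_{E′}` -/
  anBase : TemperedCurve p → An
  /-- `(Y, E′ ↪ K) ↦ Y^an_K` -/
  anOver : ∀ (Y : TemperedCurve p) (U : Untilt p), (Y.K →+* U.K) → An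

variable {p}

namespace ATSObj

variable (𝒜 : AnalyticSpaces.{u} p) {X : TemperedCurve p}

/-- **Thm 5.25.1 (4), first functor, on objects**: `(Y/E′, (E′ ↪ K, …)) ↦ Y^an_{E′}`. [claim: Joshi2021ATS1, status: disputed] -/
def anBase (A : ATSObj X) : 𝒜.An := 𝒜.anBase A.Y

/-- **Thm 5.25.1 (4), second functor, on objects**: `(Y/E′, (E′ ↪ K, …)) ↦ Y^an_K`. [claim: Joshi2021ATS1, status: disputed] -/
def anOver (A : ATSObj X) : 𝒜.An := 𝒜.anOver A.Y A.U A.emb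

/-- The first functor does not see the untilt: objects over the same curve have the SAME `Y^an_{E′}` (v4 §5.3 p.26 l.8–10: only
«Y^an_K … varies over objects of 𝔍(X,E)»). [folklore] -/
theorem anBase_eq_of_Y_eq {A B : ATSObj X} (h : A.Y = B.Y) : A.anBase 𝒜 = B.anBase 𝒜 := by
  rw [anBase, anBase, h]

/-- Relabelling by `Aut(Π)` changes neither analytic space (it only moves the label). [folklore] -/
theorem anOver_relabel (σ : X.PiTemp ≃ₜ* X.PiTemp) (A : ATSObj X) : (A.relabel σ).anOver 𝒜 = A.anOver 𝒜 := rfl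

end ATSObj

/-- **[J-I] v4 Thm 3.16.1 (2)** (p.15 l.29–44; 2021 §3 Thm (thm:main2)): for `X/E` geometrically connected smooth PROJECTIVE and two
untilts `K₁, K₂ ⊇ E` of `ℂ♭_p` that are NOT topologically isomorphic, «the analytic spaces `X^an/K₁` and `X^an/K₂` are not isomorphic as
analytic spaces over `ℚ_p`» — typed over the signature for the objects `(X, E ↪ K₁)`, `(X, E ↪ K₂)` of `𝔍(X,E)`: non-homeomorphic
perfectoid fields ⇒ non-`ℚ_p`-isomorphic analytifications over them. (Projectivity of `X` and «untilt of ℂ♭_p» are hypotheses of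
print not visible on the carriers; the Prop is stated for all objects and is the STRONGER-looking reading — graded by E-ref.) Named
claim-Prop, never asserted; Joshi's proof: `Γ(X^an_K, 𝒪) = K` as a Banach ring (§3.14–3.15). [claim: Joshi2021ATS1, status: disputed] -/
@[claim "Joshi2021ATS1" "disputed"]
def Thm3161 (𝒜 : AnalyticSpaces.{u} p) (X : TemperedCurve p) : Prop :=
  ∀ A B : ATSObj X, A.Y = X → B.Y = X → ¬ A.U.TopIso B.U → ¬ 𝒜.IsoQp (A.anOver 𝒜) (B.anOver 𝒜)

/-- **Thm 3.16.1 (1)** («one has an isomorphism of topological groups `Π^temp_{X/K₁} ≃ Π^temp_{X/K₂}`») on the carriers: the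
geometric subgroups provided by any two objects over `X` with the identity label COINCIDE (both are `Δ^temp_X`; p428170
`ATSObj.geomSubgroup`, §3 Thm (thm:main) (2),(4)). PROVED (it is the tree's reading that the geometric subgroup is `K`-independent).
[folklore] -/
theorem thm3161_clause1 {X : TemperedCurve p} (U₁ U₂ : Untilt p) (e₁ : X.K →+* U₁.K) (e₂ : X.K →+* U₂.K)
    (h₁ : Continuous fun x : ℚ_[p] => e₁ (algebraMap ℚ_[p] X.K x))
    (h₂ : Continuous fun x : ℚ_[p] => e₂ (algebraMap ℚ_[p] X.K x)) :
    (ATSObj.self X U₁ e₁ h₁).geomSubgroup = (ATSObj.self X U₂ e₂ h₂).geomSubgroup := rfl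

/-- **Thm 3.16.1 (3)** («the Absolute Grothendieck Conjecture fails in the category of Berkovich spaces over perfectoid fields of
characteristic zero») as the conjunction print draws: SAME tempered group data, DIFFERENT analytic spaces — from `Thm3161` and the
existence of non-homeomorphic residue fields (`UntiltPoints.ExistsNonIsomorphic`, [KedlayaTemkin2018]), for the labeled objects of a
points-signature. «(∃ two objects over X with equal geometric subgroup and non-isomorphic analytifications) follows from (Thm3161,
ExistsNonIsomorphic) as typed.» [claim: Joshi2021ATS1, status: disputed] -/
theorem exists_sameGroup_not_isoQp (𝒜 : AnalyticSpaces.{u} p) {𝒪E : Type} [CommRing 𝒪E] (X : TemperedCurve p)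
    (D : UntiltPoints p 𝒪E) (hT : Thm3161 𝒜 X) (hKT : D.ExistsNonIsomorphic) :
    ∃ A B : ATSObj X, A.geomSubgroup = B.geomSubgroup ∧ ¬ 𝒜.IsoQp (A.anOver 𝒜) (B.anOver 𝒜) := by
  obtain ⟨y, y', hyy'⟩ := hKT
  exact ⟨(ATSObjF.labeled X D y).toObj, (ATSObjF.labeled X D y').toObj, rfl, hT _ _ rfl rfl hyy'⟩

end Summit.ABC.IUTFork.Joshi

end
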